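import Summits.QuantumFields.BalabanUV.Beta.GAN24.LegSlotDivergenceCommute
import Summits.QuantumFields.BalabanUV.Beta.GAN24.LegFirstWindowRows

/-!
# `BalabanUV.Beta.GAN24.LegLetterSlotDivergenceRows` — binder row G-an2-4 ∕ (CONV-C), W-slot, the (α-0) parity re-cut, row L11 (Q-L): **THE WINDOW's TWO
# SLOT-DIVERGENCE ROWS OF A LEG LETTER `rdiv ∘ y` FROM THE MEMBER's TWO SLOT-LETTER ROWS** — the divergence half of the socket's (H3) ∕ (H3d) ∕ (HSL) rows in the
# window supplier's currency (G-an2-4 formalisation swarm, leaf prover `b2b-balaban-gan24-formalise-leaf-03`, gen 68; FILE 7 of the journal INTENT [LEAF03-G68-ONLINE]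
# «(H2) ⟸ THE SAME WINDOWS»; bridges leaf-01 g72's PART 4 `HalfMemberSlavedDivergenceLetters.slotLetters_halfMember_succ_of_rows` (the member's slot letters in
# leaf-03 g66's `h₁ ∕ h₂` spellings) to leaf-01 g74's window binders `hD₁ ∕ hD₂` (`LegPushDressedBoundBlockL1`) through MY g65 `LegSlotDivergenceCommute.rdiv_divV` and MY g67
# `LegFirstWindowRows.locStencil₂_rdiv`)

NOT IN PRINT; OUR BOOKKEEPING ([folklore] bookkeeping BY NAME; 0 `def`, 0 cited facts, 0 `def … : Prop`, 0 sorry; imports the TREE only).  HONEST FRAMING (cell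
contract, verbatim): «discharging `BetaPertH` makes Bałaban's UV stability UNCONDITIONAL — a real constructive-QFT result; it is NOT the continuum limit and NOT the
Clay problem.»  HONEST DEPENDENCY (verbatim): «continuum YM on T⁴ ⇐ BetaPertH ∧ nine spine estimates (0/9 proved); BetaPertH ⇐ (D1) ∧ (D4) ∧ CAP+tail; G-an2-4
gates asym, D1 and NE2/3/4.»

WHY.  The (Q-L) END's slaved rows (H3) ∕ (H3d) (and the sources' (HSL) ∕ (HSL′)) are asked in the window supplier's `GoodL` currency — the OWNER gan24-p1 g37's
`NaturalWindowH1` ∕ leaf-01 g74's `locStencil₂_legChain_bsumPow_of_dressed_envelopes{,_of_blockL1}` read a table `W` through three slot-CHARGE rows and TWO SLOT-DIVERGENCE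
rows `hD₁ : |Σ_κ (W κ (w − e_κ) κ′ v′ − W κ w κ′ v′)(x,p,f,b)| ≤ g′·e^{−δ|v′−w|₁}·e^{−δ(|x−w|₁+|p−w|₁)}`, `hD₂ : |Σ_μ (W κ v μ (w − e_μ) − W κ v μ w)(x,p,f,b)| ≤
g′·e^{−δ|w−v|₁}·e^{−δ(|x−v|₁+|p−v|₁)}` (the charges then follow from the divergences by leaf-01's `SlotChargeMoment`).  For the socket the table is a LEG LETTER
`W = rdiv ∘ y`; the member's slot divergences are SLAVED (leaf-01 g72 (b1)) and come as `LocStencil₂` rows of `p ↦ divV (κ₁ u₁ ↦ y κ₁ u₁ κ′ u′) p` (first slot, centred at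
the divergence site) and `p ↦ divV (κ₁ u₁ ↦ y κ u κ₁ u₁) p` (second slot, centred at the first slot) — PART 4's conclusion, leaf-03 g66's `h₁ ∕ h₂`.  This file is the
two-line bridge: `rdiv` commutes with `divV` (MY g65) and costs the factor `(d+1)(e^δ+1)` (MY g67 FILE 6).
WHAT (generic `d`, ANY table `y`, rate `0 ≤ δ`): **`slotDiv_fst_legLetter_le`** (`h₁` ⟹ `hD₁` for `W := rdiv ∘ y`, `g′ := (d+1)(e^δ+1)·C₁`), **`slotDiv_snd_legLetter_le`**
(`h₂` ⟹ `hD₂`, `g′ := (d+1)(e^δ+1)·C₂`) — same rate, every level at which the rows are given (so: uniform rows in ⟹ uniform rows out; geometric rows in ⟹ geometric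
rows out, by instantiating `C` with `c·ν^l`; differences in ⟹ differences out, `divV` and `rdiv` being linear).  Asserts NOTHING about Bałaban's tables; PART 4's own
inputs (p2's F4 source row — a theorem at `d = 3` by `T2RecSourceRows` ∕ MY FILE 6 —, the S-slot letter rows on the slaved summands, D1's table laws) stay where they
are; the CHARGE rows are not here; NOTHING of (Q-L) ∕ (H1♮) ∕ (C)sym discharged; NEVER «G-an2-4 closed» as (CONV-C); NOT D1, NOT `BetaPertH`, NOT continuum, NOT Clay;
not in print.  Unit `b2b-balaban-gan24-formalise-leaf-03` (gen 68), 2026-08-23.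
-/

noncomputable section
open Finset
open scoped BigOperators
open Literature.MathematicalPhysics.QuantumFieldTheory
open Literature.MathematicalPhysics.QuantumFieldTheory.Balaban1983to89
open Literature.MathematicalPhysics.QuantumFieldTheory.Balaban1983to89.Beta
open B6BondElimination (unitVec)
open B12Sec2to5 (l1)
open ExpKernelCalculus (MKer Site)
open OneStepResolventKernel (Fib)
open KernelWard (divV)
open BalabanCompositeJets (LocStencil₂)
open Summit.QuantumFields.BalabanUV.Beta.GAN24.Lin4LegTower (rdiv)
open Summit.QuantumFields.BalabanUV.Beta.GAN24.LegSlotDivergenceCommute (rdiv_divV divV_apply_gen)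
open Summit.QuantumFields.BalabanUV.Beta.GAN24.LegFirstWindowRows (locStencil₂_rdiv)

namespace Summit.QuantumFields.BalabanUV.Beta.GAN24.LegLetterSlotDivergenceRows

variable {d : ℕ}

/-- NOT IN PRINT; OUR BOOKKEEPING.  **THE FIRST-SLOT DIVERGENCE ROW `hD₁` OF THE LEG LETTER `rdiv ∘ y` FROM THE MEMBER's FIRST SLOT-LETTER ROW** (leaf-03 g66's `h₁`
spelling in, leaf-01 g74's `hD₁` spelling out): if `p ↦ divV (κ₁ u₁ ↦ y κ₁ u₁ κ′ u′) p` is `LocStencil₂` with constant `C` at rate `δ ≥ 0` (centred at the divergence site),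
then for `W := rdiv ∘ y`, `|Σ_κ (W κ (w − e_κ) κ′ v′ − W κ w κ′ v′)(x,p,f,b)| ≤ ((d+1)(e^δ+1)·C)·e^{−δ|v′−w|₁}·e^{−δ(|x−w|₁+|p−w|₁)}` — `rdiv_divV` ⨾ `locStencil₂_rdiv`. -/
theorem slotDiv_fst_legLetter_le {y : Fin (d + 1) → (Fin (d + 1) → ℤ) → Fin (d + 1) → (Fin (d + 1) → ℤ) → MKer (d + 1) (Fib d)} {C δ : ℝ} (hδ : 0 ≤ δ)
    (h₁ : LocStencil₂ (fun (_ : Fin (d + 1)) (p : Fin (d + 1) → ℤ) (κ' : Fin (d + 1)) (u' : Fin (d + 1) → ℤ) => divV (fun κ₁ u₁ => y κ₁ u₁ κ' u') p) C δ)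
    (κ' : Fin (d + 1)) (w v' x p : Fin (d + 1) → ℤ) (f b : Fib d) :
    |∑ κ, ((fun κ u κ' u' => rdiv (y κ u κ' u')) κ (w - unitVec κ) κ' v' x p f b - (fun κ u κ' u' => rdiv (y κ u κ' u')) κ w κ' v' x p f b)|
      ≤ (((d + 1 : ℕ) : ℝ) * (Real.exp δ + 1) * C) * Real.exp (-δ * l1 (v' - w)) * Real.exp (-δ * (l1 (x - w) + l1 (p - w))) := by
  -- the sum IS the leg letter of the first-slot divergence (`rdiv_divV`, pointwise)
  have e : ∑ κ, ((fun κ u κ' u' => rdiv (y κ u κ' u')) κ (w - unitVec κ) κ' v' x p f b - (fun κ u κ' u' => rdiv (y κ u κ' u')) κ w κ' v' x p f b)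
      = rdiv (divV (fun κ₁ u₁ => y κ₁ u₁ κ' v') w) x p f b := by
    rw [rdiv_divV, divV_apply_gen]
  rw [e]
  exact (locStencil₂_rdiv h₁ hδ) κ' w κ' v' x p f b

/-- NOT IN PRINT; OUR BOOKKEEPING.  **THE SECOND-SLOT DIVERGENCE ROW `hD₂` OF THE LEG LETTER `rdiv ∘ y` FROM THE MEMBER's SECOND SLOT-LETTER ROW** (leaf-03 g66's `h₂`
spelling in — centred at the FIRST slot —, leaf-01 g74's `hD₂` spelling out): if `(κ, u; ·, p) ↦ divV (κ₁ u₁ ↦ y κ u κ₁ u₁) p` is `LocStencil₂` with constant `C` at rate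
`δ ≥ 0`, then for `W := rdiv ∘ y`, `|Σ_μ (W κ v μ (w − e_μ) − W κ v μ w)(x,p,f,b)| ≤ ((d+1)(e^δ+1)·C)·e^{−δ|w−v|₁}·e^{−δ(|x−v|₁+|p−v|₁)}`. -/
theorem slotDiv_snd_legLetter_le {y : Fin (d + 1) → (Fin (d + 1) → ℤ) → Fin (d + 1) → (Fin (d + 1) → ℤ) → MKer (d + 1) (Fib d)} {C δ : ℝ} (hδ : 0 ≤ δ)
    (h₂ : LocStencil₂ (fun (κ : Fin (d + 1)) (u : Fin (d + 1) → ℤ) (_ : Fin (d + 1)) (p : Fin (d + 1) → ℤ) => divV (fun κ₁ u₁ => y κ u κ₁ u₁) p) C δ)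
    (κ : Fin (d + 1)) (v w x p : Fin (d + 1) → ℤ) (f b : Fib d) :
    |∑ μ, ((fun κ u κ' u' => rdiv (y κ u κ' u')) κ v μ (w - unitVec μ) x p f b - (fun κ u κ' u' => rdiv (y κ u κ' u')) κ v μ w x p f b)|
      ≤ (((d + 1 : ℕ) : ℝ) * (Real.exp δ + 1) * C) * Real.exp (-δ * l1 (w - v)) * Real.exp (-δ * (l1 (x - v) + l1 (p - v))) := by
  have e : ∑ μ, ((fun κ u κ' u' => rdiv (y κ u κ' u')) κ v μ (w - unitVec μ) x p f b - (fun κ u κ' u' => rdiv (y κ u κ' u')) κ v μ w x p f b)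
      = rdiv (divV (fun κ₁ u₁ => y κ v κ₁ u₁) w) x p f b := by
    rw [rdiv_divV, divV_apply_gen]
  rw [e]
  exact (locStencil₂_rdiv h₂ hδ) κ v κ w x p f b

/-- [folklore] **BOTH ROWS AT ONCE, FOR A FAMILY** (e.g. the tower members `y_l`, or their consecutive differences with `C l := c·ν^l`): per-level slot-letter rows in ⟹
per-level window divergence rows out, same constants up to `(d+1)(e^δ+1)`, same rate. -/
theorem slotDiv_legLetter_rows_of_family {y : ℕ → Fin (d + 1) → (Fin (d + 1) → ℤ) → Fin (d + 1) → (Fin (d + 1) → ℤ) → MKer (d + 1) (Fib d)} {C₁ C₂ : ℕ → ℝ} {δ : ℝ}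
    (hδ : 0 ≤ δ)
    (h₁ : ∀ l, LocStencil₂ (fun (_ : Fin (d + 1)) (p : Fin (d + 1) → ℤ) (κ' : Fin (d + 1)) (u' : Fin (d + 1) → ℤ) => divV (fun κ₁ u₁ => y l κ₁ u₁ κ' u') p) (C₁ l) δ)
    (h₂ : ∀ l, LocStencil₂ (fun (κ : Fin (d + 1)) (u : Fin (d + 1) → ℤ) (_ : Fin (d + 1)) (p : Fin (d + 1) → ℤ) => divV (fun κ₁ u₁ => y l κ u κ₁ u₁) p) (C₂ l) δ) (l : ℕ) :
    (∀ (κ' : Fin (d + 1)) (w v' x p : Fin (d + 1) → ℤ) (f b : Fib d),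
      |∑ κ, ((fun κ u κ' u' => rdiv (y l κ u κ' u')) κ (w - unitVec κ) κ' v' x p f b - (fun κ u κ' u' => rdiv (y l κ u κ' u')) κ w κ' v' x p f b)|
        ≤ (((d + 1 : ℕ) : ℝ) * (Real.exp δ + 1) * C₁ l) * Real.exp (-δ * l1 (v' - w)) * Real.exp (-δ * (l1 (x - w) + l1 (p - w)))) ∧
    (∀ (κ : Fin (d + 1)) (v w x p : Fin (d + 1) → ℤ) (f b : Fib d),
      |∑ μ, ((fun κ u κ' u' => rdiv (y l κ u κ' u')) κ v μ (w - unitVec μ) x p f b - (fun κ u κ' u' => rdiv (y l κ u κ' u')) κ v μ w x p f b)|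
        ≤ (((d + 1 : ℕ) : ℝ) * (Real.exp δ + 1) * C₂ l) * Real.exp (-δ * l1 (w - v)) * Real.exp (-δ * (l1 (x - v) + l1 (p - v)))) :=
  ⟨fun κ' w v' x p f b => slotDiv_fst_legLetter_le hδ (h₁ l) κ' w v' x p f b, fun κ v w x p f b => slotDiv_snd_legLetter_le hδ (h₂ l) κ v w x p f b⟩

end Summit.QuantumFields.BalabanUV.Beta.GAN24.LegLetterSlotDivergenceRows
end
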